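import Summits.NavierStokesRegularity.FluidComputer.BlockAmplitudeCeiling
import Literature.MathematicalPhysics.KineticTheory.TaggedSphereModeEnergy
import Mathlib.Analysis.ODE.Gronwall
import HarnessLib

/-!
# Fluid computer — L14′: the STRAIN CLOCK of a level (e-folding no faster than the coarse strain) and the RISE TIME of a saturation event

HONEST FRAMING (cell `pub-fluidc`, verbatim): *low prior, high value-of-information experiment on Tao's
machine paradigm; NOT a claim that NS blows up.* Theorem side of the cell (clocks / necessities every cascade design
must respect); nothing here is evidence of blow-up, and nothing is said about any fixed finite set of levels.

The amplitude ceiling L14 (`BlockAmplitudeCeiling.blockL2_le_add_of_forall_le`): along every maximal smooth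
finite-energy solution, `a_j(t) ≤ a_j(s) + ∫⁻_{(s,t]} G` whenever `A (a_j X_j + s_j Q_j) ≤ a_j G` on the window
(`a_l = ‖Δ̇_l u‖₂`, `s_l = ‖Δ̇_l u‖_∞`, `X_j = ∑_{|m|≤2} a_{j+m} T_{j+m}`, `T_l` the Lipschitz size of the levels below `l`,
`Q_j` the weighted energy pairs of comparable-or-finer levels). Splitting `X_j = a_j T_j + ∑_{m ≠ 0} a_{j+m} T_{j+m}` and
bounding the coarse strain and the injections on the window turns the ceiling into a linear differential inequality,
`a_j(z) ≤ a_j(x) + ∫_x^z A (Θ a_j + y)`, and Grönwall's lemma (Mathlib's `le_gronwallBound_of_liminf_deriv_right_le`, fed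
with right-slopes obtained from the ceiling and the time-continuity of `a_j`) gives:

* `blockL2_le_gronwallBound` (**L14′ — THE STRAIN CLOCK**) — if on `(s, t]` the coarse strain at level `j` is at most
  `Θ` (`T_j(τ) ≤ Θ`) and the injections are at most `y` (`∑_{m≠0} a_{j+m}T_{j+m} + C_B 2^{3j/2} Q_j ≤ y`), then
  `a_j(t) ≤ a_j(s) e^{AΘ(t−s)} + (y/Θ)(e^{AΘ(t−s)} − 1)` (`gronwallBound`; `= a_j(s) + A y (t−s)` when `Θ = 0`):
  A LEVEL E-FOLDS NO FASTER THAN `A ×` THE LIPSCHITZ SIZE OF THE LEVELS BENEATH IT. In cascade words: multiplying a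
  band's amplitude by `γ` with idle neighbours takes at least `ln γ / A` coarse-strain times `1/Θ` — the cell's turn-over
  clock `T_n ≳ 1/(k_n U_n)` (HOME/PLAN.md §0) read from below, now in AMPLITUDE (not energy-per-window, L13) currency.
* `blockL2_le_mul_exp` — the same with the elementary bound `gronwallBound δ K ε x ≤ (δ + ε x) e^{Kx}` (reused from
  the tree, `Literature.MathematicalPhysics.KineticTheory.IsModePair.gronwallBound_le_mul_exp`).
* `ofReal_mul_two_rpow_le_blockL2_of_isSaturatedLevel` — Bernstein at a saturation event: `‖Δ̇_j u‖_∞ ≥ b ν 2^j` forces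
  `‖Δ̇_j u‖₂ ≥ b ν 2^{-j/2} / C_B` (the energy of one eddy of width `2^{-j}` at the floor velocity).
* `not_isSaturatedLevel_of_gronwallBound_lt` (**THE RISE TIME OF A SATURATION EVENT**) — under the window bounds of
  L14′, level `j` is NOT saturated at time `t` as long as `C_B · gronwallBound(a_j(s), AΘ, Ay, t − s) < b ν 2^{-j/2}`: a
  level that is quiet in energy at time `s` needs, before it can carry a saturation event of the relay
  (`TerminalWindowFloor` L6, `SaturationRelay` L10), at least the time it takes `a_j(s)e^{AΘτ} + (y/Θ)(e^{AΘτ} − 1)` to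
  reach `b ν 2^{-j/2}/C_B` — logarithmic in the amplitude deficit, in units of the coarse-strain time. Necessity only.

0 sorry; no new definitions, no named facts (inputs: `BlockAmplitudeCeiling.blockL2_le_add_of_forall_le` /
`exists_blockSup_le_blockL2` / `continuousOn_blockL2` / `exists_forall_le_add_of_continuousOn`, Mathlib's Grönwall bound).

## References

* A. Cheskidov, M. Dai, *Regularity criteria for the 3D Navier–Stokes and MHD equations*, arXiv:1507.06611 =
  Proc. Edinburgh Math. Soc. (2025), §3.1, (3.6). [CheskidovDai2015]
* H. Bahouri, J.-Y. Chemin, R. Danchin, *Fourier Analysis and Nonlinear PDE*, Springer 2011, Lemma 2.1; §3.2.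
  [BahouriCheminDanchin2011]
* A. Cheskidov, R. Shvydkoy, J. Math. Fluid Mech. 16 (2014) 263–273, §3 (saturated levels, `Λ`). [CheskidovShvydkoy2011]
-/

noncomputable section

open MeasureTheory Set Function Filter Topology TemperedDistribution
open scoped ENNReal NNReal SchwartzMap
open Literature.Analysis.FluidPDE Literature.Analysis.FunctionSpaces
open Summit.NavierStokesRegularity.FluidComputer.BlockAmplitudeCeiling

namespace Summit.NavierStokesRegularity.FluidComputer.LevelStrainClock

/-! ## Bookkeeping: a constant integrand (the elementary exponential bound on `gronwallBound` is reused) -/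

/-- `∫⁻_{(x,z]} c = (z − x) · c`. [folklore] -/
theorem setLIntegral_Ioc_const (x z : ℝ) (c : ℝ≥0∞) :
    ∫⁻ _ in Ioc x z, c = ENNReal.ofReal (z - x) * c := by
  rw [setLIntegral_const, Real.volume_Ioc, mul_comm]

-- The elementary bound `gronwallBound δ K ε x ≤ (δ + ε x) e^{Kx}` (`K, ε ≥ 0`) is ALREADY in the tree as
-- `Literature.MathematicalPhysics.KineticTheory.IsModePair.gronwallBound_le_mul_exp` and is reused from there
-- (gate dedup rule), whence the kinetic-theory import.

/-! ## L14′ — the strain clock -/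

/-- **L14′ — THE STRAIN CLOCK (Grönwall form of the amplitude ceiling).** There is an absolute FINITE constant `A`
(the Littlewood–Paley constant of the transfer ceiling) such that for every `ν > 0`, `T > 0`, every maximal smooth
solution `(u, p)` of the unforced Navier–Stokes system on `ℝ³ × [0, T)` which is Leray–Hopf from `u 0`, all
`0 < s ≤ t < T`, every level `j ∈ ℤ` and all `φ, Θ, y ≥ 0`: IF on the window `(s, t]`
(i) the band's COHERENCE is at most `φ` (`‖Δ̇_j u(τ)‖_∞ ≤ φ ‖Δ̇_j u(τ)‖₂`; Bernstein always allows `φ = C_B 2^{3j/2}`,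
`blockSup_le_of_maximal`, and an incoherent band allows less),
(ii) the COARSE STRAIN at level `j` is at most `Θ` (`T_j(τ) = ∑_{l ≤ j-3} 2^l ‖Δ̇_l u(τ)‖_∞ ≤ Θ`), and
(iii) the INJECTIONS are at most `y` (`∑_{0<|m|≤2} a_{j+m}(τ) T_{j+m}(τ) + φ Q_j(τ) ≤ y`, `Q_j` the weighted energy pairs
of comparable-or-finer levels), THEN
`‖Δ̇_j u(t)‖₂ ≤ gronwallBound (‖Δ̇_j u(s)‖₂) (AΘ) (Ay) (t − s) = ‖Δ̇_j u(s)‖₂ e^{AΘ(t−s)} + (y/Θ)(e^{AΘ(t−s)} − 1)`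
(real parts; `= ‖Δ̇_j u(s)‖₂ + A y (t − s)` if `Θ = 0`). Cascade reading: a level's amplitude E-FOLDS NO FASTER than
`A ×` the Lipschitz size of the levels beneath it; multiplying it by `γ` with idle neighbours (`y = 0`) takes at least
`(ln γ)/(A Θ)` — `ln γ / A` coarse-strain (turn-over) times — and the fine-pair injection is weighted by the band's own
coherence `φ`. Proof: Grönwall's inequality (`le_gronwallBound_of_liminf_deriv_right_le`) for the continuous real function
`τ ↦ ‖Δ̇_j u(τ)‖₂`, whose right slopes are bounded through the amplitude ceiling `blockL2_le_add_of_forall_le` with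
`G = A (Θ a_j + y)` on short windows and the time-continuity of `a_j`. Ceiling only; nothing about sufficiency.
[cite: CheskidovDai2015, §3.1 (3.6)] -/
theorem blockL2_le_gronwallBound :
    ∃ A : ℝ≥0∞, A ≠ ∞ ∧ ∀ (ν T : ℝ), 0 < ν → 0 < T →
      ∀ (u : ℝ → EuclideanSpace ℝ (Fin 3) → EuclideanSpace ℝ (Fin 3)) (p : ℝ → EuclideanSpace ℝ (Fin 3) → ℝ),
      IsMaximalSmoothSolution ν 0 u p T → IsLerayHopfOn T ν 0 (u 0) u →
      ∀ s t : ℝ, 0 < s → s ≤ t → t < T → ∀ (j : ℤ) (φ Θ y : ℝ≥0),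
        (∀ τ ∈ Ioc s t, blockSup (u τ) j ≤ φ * blockL2 (u τ) j) →
        (∀ τ ∈ Ioc s t, paraT (fun l => (2 : ℝ≥0∞) ^ l * blockSup (u τ) l) j ≤ Θ) →
        (∀ τ ∈ Ioc s t,
          ∑ m ∈ (Finset.Icc (-2 : ℤ) 2).erase 0, blockL2 (u τ) (j + m) *
              paraT (fun l => (2 : ℝ≥0∞) ^ l * blockSup (u τ) l) (j + m) +
            φ * paraQ2 (blockL2 (u τ)) (fun l => (2 : ℝ≥0∞) ^ l * blockL2 (u τ) l) j ≤ y) →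
        (blockL2 (u t) j).toReal ≤
          gronwallBound (blockL2 (u s) j).toReal (A.toReal * Θ) (A.toReal * y) (t - s) := by
  obtain ⟨A, hA, H⟩ := blockL2_le_add_of_forall_le
  refine ⟨A, hA, fun ν T hν hT u p hmax hLH s t hs hst htT j φ Θ y hφ hΘ hy => ?_⟩
  classical
  set a : ℝ → ℝ≥0∞ := fun τ => blockL2 (u τ) j with ha
  obtain ⟨hcont, hfin⟩ := continuousOn_blockL2 hν hT hmax hLH j hs htT
  set K : ℝ := A.toReal * Θ with hK
  set ε : ℝ := A.toReal * y with hε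
  have hKnn : 0 ≤ K := by positivity
  -- the real-valued amplitude
  set f : ℝ → ℝ := fun τ => (a τ).toReal with hf
  have hfcont : ContinuousOn f (Icc s t) := ENNReal.continuousOn_toReal.comp hcont fun τ hτ => hfin τ hτ
  -- the domination `A (a X + s Q) ≤ a · A (Θ a + y)` on `(s, t]`
  have hdom : ∀ τ ∈ Ioc s t, A *
      (blockL2 (u τ) j * ∑ m ∈ Finset.Icc (-2 : ℤ) 2, blockL2 (u τ) (j + m) *
          paraT (fun l => (2 : ℝ≥0∞) ^ l * blockSup (u τ) l) (j + m) +
        blockSup (u τ) j * paraQ2 (blockL2 (u τ)) (fun l => (2 : ℝ≥0∞) ^ l * blockL2 (u τ) l) j) ≤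
      blockL2 (u τ) j * (A * ((Θ : ℝ≥0∞) * blockL2 (u τ) j + y)) := by
    intro τ hτ
    set Tl : ℤ → ℝ≥0∞ := fun l => paraT (fun l => (2 : ℝ≥0∞) ^ l * blockSup (u τ) l) l with hTl
    set Q := paraQ2 (blockL2 (u τ)) (fun l => (2 : ℝ≥0∞) ^ l * blockL2 (u τ) l) j
    set R := ∑ m ∈ (Finset.Icc (-2 : ℤ) 2).erase 0, blockL2 (u τ) (j + m) * Tl (j + m) with hR
    have hsplit : ∑ m ∈ Finset.Icc (-2 : ℤ) 2, blockL2 (u τ) (j + m) * Tl (j + m) =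
        blockL2 (u τ) j * Tl j + R := by
      rw [← Finset.add_sum_erase _ _ (show (0 : ℤ) ∈ Finset.Icc (-2 : ℤ) 2 by simp), add_zero, hR]
    have hInj : R + φ * Q ≤ y := hy τ hτ
    calc A * (blockL2 (u τ) j * ∑ m ∈ Finset.Icc (-2 : ℤ) 2, blockL2 (u τ) (j + m) * Tl (j + m) +
          blockSup (u τ) j * Q)
        = A * (blockL2 (u τ) j * (blockL2 (u τ) j * Tl j + R) + blockSup (u τ) j * Q) := by rw [hsplit]
      _ ≤ A * (blockL2 (u τ) j * (blockL2 (u τ) j * Θ + R) + φ * blockL2 (u τ) j * Q) := by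
          gcongr
          · exact hΘ τ hτ
          · exact hφ τ hτ
      _ = blockL2 (u τ) j * (A * (Θ * blockL2 (u τ) j + (R + φ * Q))) := by ring
      _ ≤ blockL2 (u τ) j * (A * (Θ * blockL2 (u τ) j + y)) := by gcongr
  -- the short-window ceiling: `a z ≤ a x + ∫⁻_{(x,z]} A (Θ a + y)` for `s ≤ x ≤ z ≤ t`
  have hceil : ∀ x z, s ≤ x → x ≤ z → z ≤ t →
      a z ≤ a x + ∫⁻ τ in Ioc x z, A * ((Θ : ℝ≥0∞) * a τ + y) := by
    intro x z hsx hxz hzt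
    refine H ν T hν hT u p hmax hLH x z (hs.trans_le hsx) hxz (hzt.trans_lt htT) j _ fun τ hτ => ?_
    exact hdom τ ⟨hsx.trans_lt hτ.1, hτ.2.trans hzt⟩
  -- Grönwall
  refine le_gronwallBound_of_liminf_deriv_right_le (f := f) (f' := fun x => K * f x + ε) hfcont ?_
    le_rfl (fun _ _ => le_rfl) t (right_mem_Icc.2 hst)
  intro x hx r hr
  -- room: choose `η'` with `K η' < r - (K f x + ε)`
  obtain ⟨η', hη'pos, hη'⟩ : ∃ η' : ℝ, 0 < η' ∧ K * (f x + η') + ε < r := by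
    refine ⟨(r - (K * f x + ε)) / (2 * (K + 1)), by
      apply div_pos (sub_pos.2 hr); positivity, ?_⟩
    have hK1 : 0 < K + 1 := by positivity
    have hle : K * ((r - (K * f x + ε)) / (2 * (K + 1))) ≤ (r - (K * f x + ε)) / 2 := by
      rw [mul_div_assoc', div_le_div_iff₀ (by positivity) (by norm_num)]
      nlinarith [sub_pos.2 hr]
    nlinarith
  -- continuity: `a τ ≤ a x + η'` near `x`
  have hxI : x ∈ Icc s t := Ico_subset_Icc_self hx
  obtain ⟨ρ, hρ, hnear⟩ := exists_forall_le_add_of_continuousOn hcont hxI (hfin x hxI)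
    (ENNReal.ofReal_pos.2 hη'pos)
  -- every `z ∈ (x, min (x + ρ) t)` has a small slope
  have hxt : x < min (x + ρ) t := lt_min (by linarith) hx.2
  refine Eventually.frequently ?_
  filter_upwards [Ioo_mem_nhdsGT hxt] with z hz
  have hxz : x < z := hz.1
  have hzt : z ≤ t := (hz.2.trans_le (min_le_right _ _)).le
  set M : ℝ≥0∞ := A * ((Θ : ℝ≥0∞) * (a x + ENNReal.ofReal η') + y) with hM
  have hMtop : M ≠ ∞ := by
    refine ENNReal.mul_ne_top hA (ENNReal.add_ne_top.2 ⟨ENNReal.mul_ne_top ENNReal.coe_ne_top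
      (ENNReal.add_ne_top.2 ⟨hfin x hxI, ENNReal.ofReal_ne_top⟩), ENNReal.coe_ne_top⟩)
  -- `a z ≤ a x + (z - x) M`
  have hz1 : a z ≤ a x + ENNReal.ofReal (z - x) * M := by
    refine (hceil x z hx.1 hxz.le hzt).trans ?_
    rw [← setLIntegral_Ioc_const]
    gcongr a x + ?_
    refine setLIntegral_mono' measurableSet_Ioc fun τ hτ => ?_
    have hτI : τ ∈ Icc s t := ⟨hx.1.trans hτ.1.le, hτ.2.trans hzt⟩
    have hτa : a τ ≤ a x + ENNReal.ofReal η' := by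
      refine hnear τ hτI ?_
      rw [Real.dist_eq, abs_of_pos (sub_pos.2 hτ.1)]
      linarith [hτ.2, hz.2.trans_le (min_le_left _ _)]
    simp only [hM]
    gcongr
  -- pass to real numbers
  have hax : a x ≠ ∞ := hfin x hxI
  have hzM : ENNReal.ofReal (z - x) * M ≠ ∞ := ENNReal.mul_ne_top ENNReal.ofReal_ne_top hMtop
  have hsum_top : a x + ENNReal.ofReal (z - x) * M ≠ ∞ := ENNReal.add_ne_top.2 ⟨hax, hzM⟩
  have hz2 : f z ≤ f x + (z - x) * M.toReal := by
    have h := ENNReal.toReal_mono hsum_top hz1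
    rw [ENNReal.toReal_add hax hzM, ENNReal.toReal_mul, ENNReal.toReal_ofReal (sub_nonneg.2 hxz.le)] at h
    exact h
  have haxη : a x + ENNReal.ofReal η' ≠ ∞ := ENNReal.add_ne_top.2 ⟨hax, ENNReal.ofReal_ne_top⟩
  have hΘax : (Θ : ℝ≥0∞) * (a x + ENNReal.ofReal η') ≠ ∞ := ENNReal.mul_ne_top ENNReal.coe_ne_top haxη
  have hMreal : M.toReal = K * (f x + η') + ε := by
    have hM' : M.toReal = A.toReal * ((Θ : ℝ≥0∞).toReal * ((a x).toReal + η') + (y : ℝ≥0∞).toReal) := by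
      rw [hM, ENNReal.toReal_mul, ENNReal.toReal_add hΘax ENNReal.coe_ne_top, ENNReal.toReal_mul,
        ENNReal.toReal_add hax ENNReal.ofReal_ne_top, ENNReal.toReal_ofReal hη'pos.le]
    rw [hM', ENNReal.coe_toReal, ENNReal.coe_toReal, hK, hε]
    ring
  rw [hMreal] at hz2
  have hzx : 0 < z - x := sub_pos.2 hxz
  calc (z - x)⁻¹ * (f z - f x) ≤ (z - x)⁻¹ * ((z - x) * (K * (f x + η') + ε)) := by
        gcongr; linarith
    _ = K * (f x + η') + ε := by field_simp
    _ < r := hη'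

/-- **L14′, explicit exponential form.** Under the hypotheses of `blockL2_le_gronwallBound`:
`‖Δ̇_j u(t)‖₂ ≤ ( ‖Δ̇_j u(s)‖₂ + A y (t − s) ) · e^{A Θ (t − s)}` — stock plus injected amplitude, amplified by at most
the exponential of `A ×` (coarse strain) × (elapsed time). [cite: CheskidovDai2015, §3.1 (3.6)] -/
theorem blockL2_le_mul_exp :
    ∃ A : ℝ≥0∞, A ≠ ∞ ∧ ∀ (ν T : ℝ), 0 < ν → 0 < T →
      ∀ (u : ℝ → EuclideanSpace ℝ (Fin 3) → EuclideanSpace ℝ (Fin 3)) (p : ℝ → EuclideanSpace ℝ (Fin 3) → ℝ),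
      IsMaximalSmoothSolution ν 0 u p T → IsLerayHopfOn T ν 0 (u 0) u →
      ∀ s t : ℝ, 0 < s → s ≤ t → t < T → ∀ (j : ℤ) (φ Θ y : ℝ≥0),
        (∀ τ ∈ Ioc s t, blockSup (u τ) j ≤ φ * blockL2 (u τ) j) →
        (∀ τ ∈ Ioc s t, paraT (fun l => (2 : ℝ≥0∞) ^ l * blockSup (u τ) l) j ≤ Θ) →
        (∀ τ ∈ Ioc s t,
          ∑ m ∈ (Finset.Icc (-2 : ℤ) 2).erase 0, blockL2 (u τ) (j + m) *
              paraT (fun l => (2 : ℝ≥0∞) ^ l * blockSup (u τ) l) (j + m) +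
            φ * paraQ2 (blockL2 (u τ)) (fun l => (2 : ℝ≥0∞) ^ l * blockL2 (u τ) l) j ≤ y) →
        (blockL2 (u t) j).toReal ≤
          ((blockL2 (u s) j).toReal + A.toReal * y * (t - s)) * Real.exp (A.toReal * Θ * (t - s)) := by
  obtain ⟨A, hA, H⟩ := blockL2_le_gronwallBound
  refine ⟨A, hA, fun ν T hν hT u p hmax hLH s t hs hst htT j φ Θ y hφ hΘ hy => ?_⟩
  exact (H ν T hν hT u p hmax hLH s t hs hst htT j φ Θ y hφ hΘ hy).trans
    (Literature.MathematicalPhysics.KineticTheory.IsModePair.gronwallBound_le_mul_exp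
      (by positivity) (by positivity))

/-! ## The rise time of a saturation event -/

/-- **The coherence ceiling is always available (Bernstein along the solution).** With the Bernstein constant `C_B` of
`BlockAmplitudeCeiling.exists_blockSup_le_blockL2`: every slice `u(τ)`, `τ ∈ [0, T]`, of a Leray–Hopf solution satisfies
`‖Δ̇_j u(τ)‖_∞ ≤ C_B 2^{3j/2} ‖Δ̇_j u(τ)‖₂` at every level — hypothesis (i) of `blockL2_le_gronwallBound` with
`φ = C_B 2^{3j/2}`; a measured band coherence below Bernstein's gives a smaller admissible `φ`.
[cite: BahouriCheminDanchin2011, Lemma 2.1] -/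
theorem blockSup_le_of_isLerayHopfOn :
    ∃ C : ℝ≥0, C ≠ 0 ∧ ∀ (ν T : ℝ) (u₀ : EuclideanSpace ℝ (Fin 3) → EuclideanSpace ℝ (Fin 3))
      (u : ℝ → EuclideanSpace ℝ (Fin 3) → EuclideanSpace ℝ (Fin 3)), IsLerayHopfOn T ν 0 u₀ u →
      ∀ τ ∈ Icc 0 T, ∀ j : ℤ, blockSup (u τ) j ≤ C * (2 : ℝ≥0∞) ^ (3 * (j : ℝ) / 2) * blockL2 (u τ) j := by
  obtain ⟨C, hC, hB⟩ := exists_blockSup_le_blockL2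
  exact ⟨C, hC, fun ν T u₀ u hLH τ hτ j => hB (u τ) (hLH.memLp τ hτ) j⟩

/-- **THE RISE TIME OF A SATURATION EVENT.** With the constant `A` of `blockL2_le_gronwallBound`: for every `ν > 0`,
`T > 0`, every maximal smooth solution `(u, p)` of the unforced Navier–Stokes system on `ℝ³ × [0, T)` which is
Leray–Hopf from `u 0`, all `0 < s < t < T`, every level `j ∈ ℕ`, every threshold `b`, and all window bounds
`φ, Θ, y ≥ 0` on `(s, t]` (coherence `‖Δ̇_j u‖_∞ ≤ φ ‖Δ̇_j u‖₂`, coarse strain `T_j ≤ Θ`, injections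
`∑_{0<|m|≤2} a_{j+m}T_{j+m} + φ Q_j ≤ y`): IF `φ · gronwallBound(‖Δ̇_j u(s)‖₂, AΘ, Ay, t − s) < b ν 2^j`, THEN level `j` is
NOT SATURATED at time `t` (`¬ IsSaturatedLevel b ν (u t) j`, i.e. `‖Δ̇_j u(t)‖_∞ < b ν 2^j`). Cascade reading: the
saturation events of the relay (`TerminalWindowFloor` L6: saturated levels `≥ J` in every terminal window;
`SaturationRelay` L10: strictly higher and later, without end) are PREPARED — a level quiet in energy at time `s`, under a
coarse strain `≤ Θ` with injections `≤ y` and coherence `≤ φ`, cannot fire before the RISE TIME at which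
`φ (a_j(s) e^{AΘτ} + (y/Θ)(e^{AΘτ} − 1))` reaches `b ν 2^j` — logarithmic in the amplitude deficit, in units of the
coarse-strain (turn-over) time `1/Θ`; with Bernstein's `φ = C_B 2^{3j/2}` (`blockSup_le_of_isLerayHopfOn`) the threshold is
the one-eddy amplitude `b ν 2^{-j/2}/C_B`. The atlas's hand-off clocks are read against this necessity. Necessity only;
nothing about sufficiency. [cite: CheskidovDai2015, §3.1 (3.6)] -/
theorem not_isSaturatedLevel_of_gronwallBound_lt :
    ∃ A : ℝ≥0∞, A ≠ ∞ ∧ ∀ (ν T : ℝ), 0 < ν → 0 < T →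
      ∀ (u : ℝ → EuclideanSpace ℝ (Fin 3) → EuclideanSpace ℝ (Fin 3)) (p : ℝ → EuclideanSpace ℝ (Fin 3) → ℝ),
      IsMaximalSmoothSolution ν 0 u p T → IsLerayHopfOn T ν 0 (u 0) u →
      ∀ s t : ℝ, 0 < s → s < t → t < T → ∀ (j : ℕ) (b : ℝ) (φ Θ y : ℝ≥0),
        (∀ τ ∈ Ioc s t, blockSup (u τ) j ≤ φ * blockL2 (u τ) j) →
        (∀ τ ∈ Ioc s t, paraT (fun l => (2 : ℝ≥0∞) ^ l * blockSup (u τ) l) j ≤ Θ) →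
        (∀ τ ∈ Ioc s t,
          ∑ m ∈ (Finset.Icc (-2 : ℤ) 2).erase 0, blockL2 (u τ) (j + m) *
              paraT (fun l => (2 : ℝ≥0∞) ^ l * blockSup (u τ) l) (j + m) +
            φ * paraQ2 (blockL2 (u τ)) (fun l => (2 : ℝ≥0∞) ^ l * blockL2 (u τ) l) j ≤ y) →
        (φ : ℝ) * gronwallBound (blockL2 (u s) j).toReal (A.toReal * Θ) (A.toReal * y) (t - s) <
          b * ν * (2 : ℝ) ^ j →
        ¬ IsSaturatedLevel b ν (u t) j := by
  obtain ⟨A, hA, H⟩ := blockL2_le_gronwallBound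
  refine ⟨A, hA, fun ν T hν hT u p hmax hLH s t hs hst htT j b φ Θ y hφ hΘ hy hlt hsat => ?_⟩
  have hG := H ν T hν hT u p hmax hLH s t hs hst.le htT j φ Θ y hφ hΘ hy
  set g := gronwallBound (blockL2 (u s) (j : ℤ)).toReal (A.toReal * Θ) (A.toReal * y) (t - s) with hg
  have hfin : blockL2 (u t) (j : ℤ) ≠ ∞ :=
    ((continuousOn_blockL2 hν hT hmax hLH (j : ℤ) hs htT).2 t (right_mem_Icc.2 hst.le))
  -- saturation and the coherence bound: `b ν 2^j ≤ φ ‖Δ̇_j u(t)‖₂`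
  have h1 : ENNReal.ofReal (b * ν) * (2 : ℝ≥0∞) ^ j ≤ φ * blockL2 (u t) j :=
    hsat.trans (hφ t ⟨hst, le_rfl⟩)
  have h2 : (ENNReal.ofReal (b * ν) * (2 : ℝ≥0∞) ^ j).toReal ≤ (φ : ℝ) * (blockL2 (u t) j).toReal := by
    have := ENNReal.toReal_mono (ENNReal.mul_ne_top ENNReal.coe_ne_top hfin) h1
    rwa [ENNReal.toReal_mul (a := (φ : ℝ≥0∞)), ENNReal.coe_toReal] at this
  have h3 : (φ : ℝ) * (blockL2 (u t) j).toReal ≤ (φ : ℝ) * g := mul_le_mul_of_nonneg_left hG φ.2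
  rcases le_or_gt 0 (b * ν) with hbν | hbν
  · rw [ENNReal.toReal_mul, ENNReal.toReal_ofReal hbν, ENNReal.toReal_pow, ENNReal.toReal_ofNat] at h2
    linarith
  · -- `b ν < 0`: the strict hypothesis contradicts `0 ≤ φ g`
    have hg0 : 0 ≤ (φ : ℝ) * g := le_trans (mul_nonneg φ.2 ENNReal.toReal_nonneg) h3
    have : b * ν * (2 : ℝ) ^ j < 0 := mul_neg_of_neg_of_pos hbν (by positivity)
    linarith

end Summit.NavierStokesRegularity.FluidComputer.LevelStrainClock

end
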